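import Summits.BirchSwinnertonDyer.Rank1Residual.X5.SelmerSolitaireOnePrimeMoves
import HarnessLib

/-!
# X5 / O1 (p = 2), lens-2 "Selmer solitaire": the ONE-PRIME CONNECTION THEOREM T4 (stub₂′) in its
# STRONG form, and `onePrimeConnection_holds : OnePrimeConnection`

HONEST FRAMING (cell `b2b-bsdres`, run/shared/lean/b2b/bsd-rank1-residual/, verbatim in every
file): the goal of the cell is to DELETE the COMBINATION-SHAPED residual classes of the
Birch–Swinnerton-Dyer formula for ALL analytic-rank `≤ 1` elliptic curves over `ℚ` — assembled
STRICTLY from published theorems — so that the rank-`≤ 1` remainder becomes exactly the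
CONSTRUCTION-SHAPED classes, which are TYPED (missing-input `Prop`s), NOT attempted. This is not
"finishing BSD". Cell O1 (`p = 2`): research route; O1 OPEN; nothing booked; no mark / label / count
moved. THEOREMS ONLY (no definition, no named fact, no `sorry`); pure `𝔽₂` linear algebra on lens-2's
normal form (x11b3-p4's vocabulary `X5/SelmerSolitaire.lean`, p272248, IMPORTED VERBATIM — nothing
re-declared); reach-neutral: the dictionary to Kolyvagin primes / 2-Selmer structures (stub₁′) is
NOT asserted here, and R1 / X0CONN₂ closes no class by itself.

WHAT THIS FILE PROVES (o1 PROVER ORDER v2.8 (ii′); second hand x11b3-p2, split agreed with the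
holder x11b3-p4, who landed stub₂″ `pivotRebase_holds`). For a position `P` (simple graph `Γ̂` on
`D ⊔ {∞}`, `core n ⟺ det Ŝ[n⁺] = 1`) and a core `B ⊆ D`:

* `core_withNew_empty` — level `0`: `{q}` is core as soon as `q ~ ∞`.
* **`exists_extend_chain`** — for EVERY prescription `ψ` of the new vertex's adjacency to the old
  primes OUTSIDE `B` there is a neighbourhood `N` (`N ∞ = 1`, `N|_{D∖B} = ψ`) and an ordering
  `b₁, …, b_d` of `B` such that in the one-vertex extension `extend P N` (new prime `q`) ALL of
  `{q}, {b₁,q}, …, B ∪ {q}` are core;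
* **`onePrimeConnection_strong`** — the same in the vocabulary's `∃ P', Extends P P'` spelling (the
  spelling of record agreed with x11b3-p4 for T4′);
* **`onePrimeConnection_holds : OnePrimeConnection`** — lens-2's stub₂′ (G5.3 T4) AS WRITTEN.

PROOF (a simplification of lens-2 G5.3 Steps 1–4 found while formalising: no Jacobi chain is fixed in
advance and NO orientation step is needed). Complete induction on `|B|` inside the one position `P`,
with the two moves of `X5/SelmerSolitaireOnePrimeMoves.lean`: (i) if some `b ∈ B` has `B ∖ b` core,
take the chain for `B ∖ b` (induction; `N` free at `b`, and changing `N b` does not disturb the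
earlier conditions, `core_extend_update_iff`) and fix the last condition by `N b`
(`exists_update_core_withNew`); (ii) otherwise `|B|` is even (`exists_erase_core_of_odd`) and for
`u ∈ B` some `v` has `B ∖ {u,v}` core (`exists_erase_erase_core_of_even`); take the chain for
`B ∖ {u,v}`, fix the condition for `B ∖ v` by `N u`, and the last condition is AUTOMATIC
(`core_withNew_of_pair`). Every step was checked exhaustively for `s ≤ 4` before formalisation
(`HOME/b2b-bsdres-x11b3-p2/o1/plan_check.py`: 49 088 `(P, B, ψ)` instances; EVIDENCE only — the
kernel proof below is the record).

References: lens-2 GEN 5 addendum G5.2–G5.3, G5.10 (`HOME/b2b-bsdres-o1-idea-2-g5/`); B. Mazur,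
K. Rubin, *Kolyvagin systems* (2004) §4.3 (the graph `𝒳⁰`; background only, nothing cited as fact).
-/

namespace Summit.BirchSwinnertonDyer.Rank1Residual.X5.SelmerSolitaire

open Finset Matrix

variable {s : ℕ}

/-! ### §4 Level zero, the induction, and the one-prime connection theorem -/

/-- Level `0`: `{q}` is core in `extend P N` as soon as `N ∞ = 1` (the minor on `{q, ∞'}` is
`[[0, N ∞], [N ∞, 0]]`). [folklore] -/
theorem core_withNew_empty (P : Position s) (N : V s → ZMod 2) (hN : N none = 1) :
    Core (extend P N) (withNew ∅) := by
  classical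
  set S' := (extend P N).S with hS'
  set q : V (s + 1) := some (Fin.last s) with hq
  set p : V (s + 1) := oldV none with hp
  have hpq : p ≠ q := oldV_ne_new _
  have hX0 : (plus (∅ : Finset (Fin s))).image oldV = (∅ : Finset (V (s + 1))) := by
    simp [plus]
  have hXdet : (S'.submatrix (Subtype.val : ↥(∅ : Finset (V (s + 1))) → V (s + 1))
      Subtype.val).det ≠ 0 := by
    haveI : IsEmpty ↥(∅ : Finset (V (s + 1))) := ⟨fun x => Finset.notMem_empty x.1 x.2⟩
    rw [Matrix.det_isEmpty]
    exact one_ne_zero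
  have h0X : ∀ i, i ∉ (∅ : Finset (V (s + 1))) → (0 : V (s + 1) → ZMod 2) i = 0 := fun _ _ => rfl
  have h0 : ∀ (c : V (s + 1)), ∀ i ∈ (∅ : Finset (V (s + 1))), (S' *ᵥ 0) i = S' i c :=
    fun c i hi => absurd hi (Finset.notMem_empty i)
  have key := Alt.det_insert_insert_eq_one_iff (extend P N).symm (extend P N).loopless
    (Finset.notMem_empty p) (Finset.notMem_empty q) hpq hXdet h0X (h0 p) h0X (h0 q)
  unfold Core
  rw [plus_withNew_eq_of_even (by simp : Even (∅ : Finset (Fin s)).card), hX0, Finset.insert_comm]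
  refine key.mpr ?_
  rw [Matrix.mulVec_zero, Pi.zero_apply, add_zero, hq, hp, extend_S_new_oldV, hN]

/-- **Chains exist, STRONG form** (`exists_extend_chain`): for a core `B` and EVERY prescription `ψ`
of the new prime's adjacency to the old primes outside `B`, there is a neighbourhood `N` with
`N ∞ = 1`, `N|_{D ∖ B} = ψ` and an ordering `l` of `B` all of whose prefixes `T` have `T ∪ {q}` core
in `extend P N`. Complete induction on `|B|`: §2 (one move) when some `B ∖ b` is core, else §1 + §2
+ §3 (two moves, the last one free). [folklore] -/
theorem exists_extend_chain (P : Position s) (B : Finset (Fin s)) (hB : Core P B)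
    (ψ : Fin s → ZMod 2) :
    ∃ N : V s → ZMod 2, N none = 1 ∧ (∀ x, x ∉ B → N (some x) = ψ x) ∧
      ∃ l : List (Fin s), l.Nodup ∧ l.toFinset = B ∧
        ∀ i ≤ l.length, Core (extend P N) (withNew (l.take i).toFinset) := by
  classical
  suffices h : ∀ (n : ℕ) (B : Finset (Fin s)), B.card ≤ n → Core P B →
      ∃ N : V s → ZMod 2, N none = 1 ∧ (∀ x, x ∉ B → N (some x) = ψ x) ∧
        ∃ l : List (Fin s), l.Nodup ∧ l.toFinset = B ∧
          ∀ i ≤ l.length, Core (extend P N) (withNew (l.take i).toFinset) from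
    h B.card B le_rfl hB
  intro n
  induction n with
  | zero =>
    intro B hB0 _
    have hBe : B = ∅ := Finset.card_eq_zero.mp (Nat.le_zero.mp hB0)
    subst hBe
    refine ⟨fun v => v.elim 1 ψ, rfl, fun x _ => rfl, [], List.nodup_nil, rfl, fun i hi => ?_⟩
    have hi0 : i = 0 := Nat.le_zero.mp hi
    subst hi0
    exact core_withNew_empty P _ rfl
  | succ n ih =>
    intro B hBn hB
    by_cases hlt : B.card ≤ n
    · exact ih B hlt hB
    have hcard : B.card = n + 1 := by omega
    by_cases hcase : ∃ b ∈ B, Core P (B.erase b)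
    · /- (i): one move, last condition fixed by `N b` -/
      obtain ⟨b, hb, hB₁⟩ := hcase
      have hcard₁ : (B.erase b).card ≤ n := by
        rw [Finset.card_erase_of_mem hb]; omega
      obtain ⟨N₀, hN₀, hψ₀, l₀, hl₀, hl₀B, hchain₀⟩ := ih (B.erase b) hcard₁ hB₁
      obtain ⟨t, ht⟩ := exists_update_core_withNew P N₀ hb hB₁
      have hbl₀ : b ∉ l₀ := fun h => by
        have : b ∈ l₀.toFinset := List.mem_toFinset.mpr h
        rw [hl₀B] at this
        exact Finset.notMem_erase b B this
      refine ⟨Function.update N₀ (some b) t, ?_, ?_, l₀ ++ [b], ?_, ?_, ?_⟩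
      · rw [Function.update_of_ne (Option.some_ne_none b).symm]
        exact hN₀
      · intro x hx
        have hxb : (some x : V s) ≠ some b := fun h => hx (by cases h; exact hb)
        have hx' : x ∉ B.erase b := fun h => hx (Finset.mem_of_mem_erase h)
        rw [Function.update_of_ne hxb, hψ₀ x hx']
      · rw [List.nodup_append_comm]
        exact List.nodup_cons.mpr ⟨hbl₀, hl₀⟩
      · rw [List.toFinset_append, hl₀B]
        simp [Finset.insert_erase hb]
      · intro i hi
        rw [List.length_append, List.length_singleton] at hi
        by_cases hi' : i ≤ l₀.length
        · rw [List.take_append_of_le_length hi']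
          have hbT : b ∉ (l₀.take i).toFinset := fun h =>
            hbl₀ (List.mem_of_mem_take (List.mem_toFinset.mp h))
          rw [core_extend_update_iff P N₀ hbT]
          exact hchain₀ i hi'
        · have hi2 : i = (l₀ ++ [b]).length := by
            rw [List.length_append, List.length_singleton]; omega
          rw [hi2, List.take_length, List.toFinset_append, hl₀B]
          have hBb : B.erase b ∪ [b].toFinset = B := by simp [Finset.insert_erase hb]
          rw [hBb]
          exact ht
    · /- (ii): two moves, last condition automatic -/
      push Not at hcase
      have heven : Even B.card := by
        by_contra hodd
        obtain ⟨b, hb, hb'⟩ := exists_erase_core_of_odd P hB hodd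
        exact hcase b hb hb'
      have hne : B.Nonempty := by
        rw [← Finset.card_pos, hcard]; omega
      obtain ⟨u, hu⟩ := hne
      obtain ⟨v, hv, hvu, hB''⟩ := exists_erase_erase_core_of_even P hB heven hu
      have huv : u ≠ v := fun h => hvu h.symm
      have hvBu : v ∈ B.erase u := Finset.mem_erase.mpr ⟨hvu, hv⟩
      have huBv : u ∈ B.erase v := Finset.mem_erase.mpr ⟨huv, hu⟩
      have hcard'' : ((B.erase u).erase v).card ≤ n := by
        have h1 := Finset.card_erase_add_one hu
        have h2 := Finset.card_erase_add_one hvBu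
        omega
      obtain ⟨N₀, hN₀, hψ₀, l₀, hl₀, hl₀B, hchain₀⟩ := ih _ hcard'' hB''
      -- fix the condition for `B ∖ v = (B ∖ {u,v}) ∪ {u}` by `N u`
      have hBvu : Core P ((B.erase v).erase u) := by
        rw [Finset.erase_right_comm]; exact hB''
      obtain ⟨t, ht⟩ := exists_update_core_withNew P N₀ huBv hBvu
      have hul₀ : u ∉ l₀ := fun h => by
        have : u ∈ l₀.toFinset := List.mem_toFinset.mpr h
        rw [hl₀B, Finset.erase_right_comm] at this
        exact Finset.notMem_erase u _ this
      have hvl₀ : v ∉ l₀ := fun h => by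
        have : v ∈ l₀.toFinset := List.mem_toFinset.mpr h
        rw [hl₀B] at this
        exact Finset.notMem_erase v _ this
      have hcond : Core (extend P (Function.update N₀ (some u) t)) (withNew ((B.erase u).erase v)) := by
        have huB'' : u ∉ (l₀.take l₀.length).toFinset := fun h =>
          hul₀ (List.mem_of_mem_take (List.mem_toFinset.mp h))
        have h := hchain₀ l₀.length le_rfl
        rw [← core_extend_update_iff P N₀ huB'' t] at h
        rw [List.take_length, hl₀B] at h
        exact h
      have hlast : Core (extend P (Function.update N₀ (some u) t)) (withNew B) :=
        core_withNew_of_pair P _ hu hv huv heven hB hB'' (hcase v hv) (hcase u hu) hcond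
      refine ⟨Function.update N₀ (some u) t, ?_, ?_, l₀ ++ [u, v], ?_, ?_, ?_⟩
      · rw [Function.update_of_ne (Option.some_ne_none u).symm]
        exact hN₀
      · intro x hx
        have hxu : (some x : V s) ≠ some u := fun h => hx (by cases h; exact hu)
        have hx' : x ∉ (B.erase u).erase v := fun h =>
          hx (Finset.mem_of_mem_erase (Finset.mem_of_mem_erase h))
        rw [Function.update_of_ne hxu, hψ₀ x hx']
      · rw [List.nodup_append_comm]
        refine List.nodup_cons.mpr ⟨?_, List.nodup_cons.mpr ⟨hvl₀, hl₀⟩⟩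
        simpa [huv] using hul₀
      · rw [List.toFinset_append, hl₀B]
        ext x
        simp only [Finset.mem_union, Finset.mem_erase, List.toFinset_cons, List.toFinset_nil,
          Finset.mem_insert, Finset.notMem_empty, or_false]
        constructor
        · rintro (⟨-, -, hx⟩ | rfl | rfl) <;> assumption
        · intro hx
          by_cases hxu : x = u
          · exact Or.inr (Or.inl hxu)
          · by_cases hxv : x = v
            · exact Or.inr (Or.inr hxv)
            · exact Or.inl ⟨hxv, hxu, hx⟩
      · intro i hi
        rw [List.length_append] at hi
        simp only [List.length_cons, List.length_nil] at hi
        by_cases hi' : i ≤ l₀.length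
        · rw [List.take_append_of_le_length hi']
          have huT : u ∉ (l₀.take i).toFinset := fun h =>
            hul₀ (List.mem_of_mem_take (List.mem_toFinset.mp h))
          rw [core_extend_update_iff P N₀ huT]
          exact hchain₀ i hi'
        · by_cases hi1 : i = l₀.length + 1
          · subst hi1
            have htake : (l₀ ++ [u, v]).take (l₀.length + 1) = l₀ ++ [u] := by
              rw [show l₀ ++ [u, v] = l₀ ++ [u] ++ [v] by simp,
                List.take_append_of_le_length (by simp), List.take_of_length_le (by simp)]
            rw [htake]
            have hset : (l₀ ++ [u]).toFinset = B.erase v := by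
              rw [List.toFinset_append, hl₀B]
              ext x
              simp only [Finset.mem_union, Finset.mem_erase, List.toFinset_cons, List.toFinset_nil,
                Finset.mem_insert, Finset.notMem_empty, or_false]
              constructor
              · rintro (⟨hxv, -, hx⟩ | rfl)
                · exact ⟨hxv, hx⟩
                · exact ⟨huv, hu⟩
              · rintro ⟨hxv, hx⟩
                by_cases hxu : x = u
                · exact Or.inr hxu
                · exact Or.inl ⟨hxv, hxu, hx⟩
            rw [hset]
            exact ht
          · have hi2 : i = (l₀ ++ [u, v]).length := by
              rw [List.length_append]; simp only [List.length_cons, List.length_nil]; omega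
            rw [hi2, List.take_length]
            have hset : (l₀ ++ [u, v]).toFinset = B := by
              rw [List.toFinset_append, hl₀B]
              ext x
              simp only [Finset.mem_union, Finset.mem_erase, List.toFinset_cons, List.toFinset_nil,
                Finset.mem_insert, Finset.notMem_empty, or_false]
              constructor
              · rintro (⟨-, -, hx⟩ | rfl | rfl) <;> assumption
              · intro hx
                by_cases hxu : x = u
                · exact Or.inr (Or.inl hxu)
                · by_cases hxv : x = v
                  · exact Or.inr (Or.inr hxv)
                  · exact Or.inl ⟨hxv, hxu, hx⟩
            rw [hset]
            exact hlast

/-- **T4, STRONG FORM (one-prime connection with prescribed outside adjacency).** For every position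
`P`, every core `B ⊆ D` and EVERY `ψ : D → 𝔽₂` there are a one-vertex extension `P'` of `P` whose new
prime `q` is adjacent to each old prime `x ∉ B` exactly when `ψ x = 1`, and an ordering
`b₁, …, b_d` of `B` with `{q}, {b₁,q}, …, B ∪ {q}` all core in `P'`. (The freedom off `B` is what
T4′'s parity argument consumes — x11b3-p4.) Spelling of record agreed on INBOX 2026-08-21.
[folklore] -/
theorem onePrimeConnection_strong (P : Position s) (B : Finset (Fin s)) (hB : Core P B)
    (ψ : Fin s → ZMod 2) :
    ∃ (P' : Position (s + 1)) (l : List (Fin s)),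
      Extends P P' ∧ (∀ x, x ∉ B → P'.S (some (Fin.last s)) (oldV (some x)) = ψ x) ∧
      l.Nodup ∧ l.toFinset = B ∧ ∀ i ≤ l.length, Core P' (withNew (l.take i).toFinset) := by
  obtain ⟨N, -, hNψ, l, hl, hlB, hchain⟩ := exists_extend_chain P B hB ψ
  exact ⟨extend P N, l, extend_extends P N, fun x hx => by rw [extend_S_new_oldV]; exact hNψ x hx,
    hl, hlB, hchain⟩

/-- **lens-2's stub₂′ `OnePrimeConnection` (G5.3 T4) AS WRITTEN holds**: for every position on
`D ⊔ {∞}` and every core `B ⊆ D` there are a one-vertex extension and an ordering `b₁, …, b_d` of `B`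
with `{q}, {b₁, q}, …, B ∪ {q}` all core. Pure `𝔽₂` linear algebra; the dictionary to Kolyvagin
primes (stub₁′) is not asserted; nothing arithmetic follows from this file alone. [folklore] -/
theorem onePrimeConnection_holds : OnePrimeConnection := by
  intro s P B hB
  obtain ⟨P', l, hE, -, hl, hlB, hchain⟩ := onePrimeConnection_strong P B hB (fun _ => 0)
  exact ⟨P', l, hE, hl, hlB, hchain⟩


end Summit.BirchSwinnertonDyer.Rank1Residual.X5.SelmerSolitaire
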